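import Summits.PneNP.PneNP.Theorems.OneSliceSliceTargetReplica
import Summits.PneNP.PneNP.Theorems.OneSliceSliceTargetSubthreshold
import Summits.PneNP.PneNP.Theorems.SliceTarget.Negative.LineTargets

/-!
# `SliceTarget` (stmt-PneNP-2832), line `Sketch-ideator3-r1` — the PARITY quarter transfer (T8″ `stub_transferQuarter`)

Helper file for the crux `Summit.PneNP.PneNP.Theses.OneSlice.SliceTarget` (route PneNP/OneSlice), namespace of the line
skeleton `Cruxes/SliceTarget/Lines/Sketch_ideator3_r1.lean`. Two results:

* `bigBlindFloor_of` — **the quarter floor**: from B2 (clique density on central slices `≥ λ − λ²/2 − ε`, `λ = 1/k!`,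
  landed as `stub_cliqueDensityLower`) and B3 (the replica pair bound `Σ_Φ (#{x ∈ Φ : CLIQUE_k})²/#Φ ≤ (λ² + λ|F|/N + ε)·#slice`
  over the fibres of a read set `F` with `2|F| ≤ N`, landed as `stub_pairBound`), both taken as hypotheses: for `k ≥ 4` and
  `δ = λ/8`, eventually every `δ`-accurate `{∧₂,∨₂}`-circuit on a central critical slice has `C(n,2) ≤ 4·size + 1` — a circuit
  with fewer gates reads a slot set `F` with `2|F| ≤ N` and, by replica decoupling (`replica_decoupling`, landed), errs on
  `≥ (λ − λ²/2 − ε) − (λ² + λ(1/2 + 1/N) + ε) ≥ 5λ/16 > δ` of the slice.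
* `stub_transferQuarter` — **T8″**: `CoincidenceTail2 → CliqueDensityLower → PairBound → ParitySliceHardQuarter →
  ParitySliceHardWindow` (all expanded): the threshold-windowed parity hardness T7′ (`m_k(n) ≤ 16·size + 8`) follows from the
  quarter-windowed one T7″ (`C(n,2) ≤ 4·size + 1`), because between the two windows the quarter floor already refutes
  `λ/8`-accuracy, and parity accuracy `δ` gives clique accuracy `δ + (λ²/2 + ε)` off the coincidence tail (T5).

Relation to `Theorems/OneSliceSliceTargetQuarter.lean` (lead -1, p96336): that file proves the quarter floor UNCONDITIONALLY for
every `k ≥ 3` in clique form (`bigBlindFloor`) and the exact window reduction `quarter_iff_sliceTargetFrom2` (stub T9); this file is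
the parity-form transfer T8″ registered earlier (hypothesis form, `k ≥ 4`), which makes the parity crux-let T7″ a sufficient
condition for T9 (`sliceHardQuarter_of_parityQuarter` in the skeleton). The coincidence `CLIQUE_k = [2 ∤ ω_k]` off `{ω_k ≥ 2}` is
the disprover's landed `cliqueFn_eq_parity_of_lt_two` (Theorems/SliceTarget/Negative/LineTargets.lean). Proof written by lead prover-line-stmt-PneNP-2832-0
(skeleton v5/v6, 2026-08-16), landed by the continuation lead prover-line-stmt-PneNP-2832-c1-0; imports only BUILT landed modules.
-/

set_option linter.dupNamespace false

namespace Summit.PneNP.PneNP.Cruxes.SliceTarget.Ideator3Line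

open Literature.Computability.Complexity Finset Filter Classical
open scoped Topology
open Summit.PneNP.PneNP.Theorems.ConstantBand.Negative (Edge thr Central central_thr slice errSet)
open Summit.PneNP.PneNP.Theorems.SingleThreshold.Negative (Edges Touch zeroOn inputList eval_congr
  length_inputList_le arity_le_two_of_isOver zeroOn_le zeroOn_congr_off touch_of_ne pc pc_nonneg pc_le_one tendsto_pc
  pc_pow_choose)
open Summit.PneNP.PneNP.Theorems.SliceACZero.Negative (sliceCard sliceCard_eq)

noncomputable section


/-- **The quarter floor (assembly).** From B2 (clique density `≥ λ − λ²/2 − ε` from below) and B3 (pair bound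
`≤ λ² + λ|F|/N + ε` for `2|F| ≤ N`): for every `k ≥ 4` (`λ = 1/k! ≤ 1/24`), with `δ = λ/8`, eventually every `δ`-accurate
`{∧₂,∨₂}`-circuit on a central slice has `C(n,2) ≤ 4·size + 1`. Otherwise its read set `F` (`|F| ≤ 2·size + 1`) has
`2|F| ≤ N`, and by replica decoupling its error is `≥ (λ − λ²/2 − ε) − (λ² + λ(1/2 + 1/N) + ε) ≥ 5λ/16 > δ`
(`ε = λ/32`, `N ≥ 16`). [folklore] -/
theorem bigBlindFloor_of
    (hB2 : ∀ k : ℕ, 3 ≤ k → ∀ ε : ℝ, 0 < ε → ∀ᶠ n : ℕ in atTop, ∀ j : ℕ, Central k n j →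
      (1 / (k.factorial : ℝ) - (1 / (k.factorial : ℝ)) ^ 2 / 2 - ε) * #(slice n j) ≤
        #((slice n j).filter fun x => cliqueFn n k x = true))
    (hB3 : ∀ k : ℕ, 3 ≤ k → ∀ ε : ℝ, 0 < ε → ∀ᶠ n : ℕ in atTop, ∀ j : ℕ, Central k n j →
      ∀ F : Finset (Edge n), 2 * #F ≤ n.choose 2 →
        ∑ ρ ∈ (slice n j).image (fun x e => if e ∈ F then x e else false),
            (#((slice n j).filter fun x => (∀ e ∈ F, x e = ρ e) ∧ cliqueFn n k x = true) : ℝ) ^ 2 /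
              #((slice n j).filter fun x => ∀ e ∈ F, x e = ρ e) ≤
          ((1 / (k.factorial : ℝ)) ^ 2 + 1 / (k.factorial : ℝ) * (#F / (n.choose 2 : ℕ)) + ε) * #(slice n j))
    {k : ℕ} (hk : 4 ≤ k) :
    ∀ᶠ n : ℕ in atTop, ∀ j : ℕ, Central k n j → ∀ C : Circuit (Edge n), C.IsOver monotoneBasis →
      (#(errSet n k j C) : ℝ) ≤ 1 / (k.factorial : ℝ) / 8 * #(slice n j) → n.choose 2 ≤ 4 * C.size + 1 := by
  have hk3 : 3 ≤ k := by omega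
  set lam : ℝ := 1 / (k.factorial : ℝ) with hlam
  have hlam0 : 0 < lam := by positivity
  have hlam24 : lam ≤ 1 / 24 := by
    have h : (Nat.factorial 4 : ℝ) ≤ k.factorial := by exact_mod_cast Nat.factorial_le hk
    have h4 : (Nat.factorial 4 : ℝ) = 24 := by norm_num [Nat.factorial]
    rw [hlam]
    exact one_div_le_one_div_of_le (by norm_num) (by linarith)
  set ε : ℝ := lam / 32 with hε
  have hε0 : 0 < ε := by positivity
  filter_upwards [hB2 k hk3 ε hε0, hB3 k hk3 ε hε0, window_general hk3, eventually_ge_atTop 8] with n h2 h3 hW hn8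
  intro j hj C hC herr
  obtain ⟨_, hjN, _, _, hN⟩ := hW j hj
  by_contra hsmall
  push Not at hsmall
  -- the read set is at most half of the slots
  set F : Finset (Edge n) := (inputList C).toFinset with hFdef
  have hFmem : ∀ i ∈ inputList C, i ∈ F := fun i hi => List.mem_toFinset.2 hi
  have hF2 : 2 * #F ≤ n.choose 2 := by
    have h1 : #F ≤ (inputList C).length := List.toFinset_card_le _
    have h2' := length_inputList_le C (arity_le_two_of_isOver hC)
    omega
  have hf : ∀ x y : Edge n → Bool, (∀ e ∈ F, x e = y e) → C.eval x = C.eval y :=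
    fun x y hxy => eval_congr C fun i hi => hxy i (hFmem i hi)
  -- replica decoupling with `g = CLIQUE_k`
  have hrep := replica_decoupling n j F (fun x => C.eval x) (cliqueFn n k) hf
  have h2' := h2 j hj
  have h3' := h3 j hj F hF2
  have hS0 : (0 : ℝ) ≤ #(slice n j) := Nat.cast_nonneg _
  have hSpos : (0 : ℝ) < #(slice n j) := by
    have : #(slice n j) = (n.choose 2).choose j := sliceCard_eq n j
    rw [this]
    exact_mod_cast Nat.choose_pos hjN
  -- `|F|/N ≤ 1/2 + …`: we use `2|F| ≤ N` as `|F|/N ≤ 1/2`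
  have hNr : (0 : ℝ) < (n.choose 2 : ℕ) := by exact_mod_cast hN
  have hFN : (#F : ℝ) / (n.choose 2 : ℕ) ≤ 1 / 2 := by
    rw [div_le_iff₀ hNr]
    have : (2 * #F : ℝ) ≤ (n.choose 2 : ℕ) := by exact_mod_cast hF2
    linarith
  -- the error set of `C` on the slice is `{C ≠ CLIQUE}`
  have herr' : (#((slice n j).filter fun x => (fun x => C.eval x) x ≠ cliqueFn n k x) : ℝ) = #(errSet n k j C) := by
    congr 2
    ext x
    simp only [mem_filter, errSet, Summit.PneNP.PneNP.Theorems.ConstantBand.Negative.slice, mem_univ, true_and]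
  rw [herr'] at hrep
  -- combine
  have hpair : ∑ ρ ∈ (slice n j).image (fun x e => if e ∈ F then x e else false),
      (#((slice n j).filter fun x => (∀ e ∈ F, x e = ρ e) ∧ cliqueFn n k x = true) : ℝ) ^ 2 /
        #((slice n j).filter fun x => ∀ e ∈ F, x e = ρ e) ≤ (lam ^ 2 + lam * (1 / 2) + ε) * #(slice n j) := by
    refine h3'.trans (mul_le_mul_of_nonneg_right ?_ hS0)
    have : lam * ((#F : ℝ) / (n.choose 2 : ℕ)) ≤ lam * (1 / 2) := mul_le_mul_of_nonneg_left hFN hlam0.le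
    linarith
  have hmain : (lam - lam ^ 2 / 2 - ε) * #(slice n j) - (lam ^ 2 + lam * (1 / 2) + ε) * #(slice n j) ≤
      lam / 8 * #(slice n j) := by linarith
  have hcoef : lam / 8 < (lam - lam ^ 2 / 2 - ε) - (lam ^ 2 + lam * (1 / 2) + ε) := by
    rw [hε]; nlinarith
  nlinarith

/-- **stub T8″ `stub_transferQuarter`** of line `Sketch-ideator3-r1` (crux stmt-PneNP-2832): the coincidence tail T5, the
clique density B2, the pair bound B3 and the QUARTER-windowed parity hardness T7″ (`k ≥ 4`, circuits with
`C(n,2) ≤ 4·size + 1` only) imply the THRESHOLD-windowed parity hardness T7′ (hypothesis of the landed T8): given `c ≥ 2`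
and `(k, δ)` from T7″, put `t = (1/k!)²`, `δ′ = min δ ((λ/8 − t/2)/2) > t` (`λ = 1/k! ≤ 1/24`); a circuit erring against
the parity on `≤ δ′·#slice` errs against `CLIQUE_k` on `≤ (δ′ + t/2 + ε)·#slice ≤ (λ/8)·#slice`, so the quarter floor puts it
in the window `C(n,2) ≤ 4·size + 1`, where T7″ applies. [folklore] -/
theorem stub_transferQuarter :
    (∀ k : ℕ, 3 ≤ k → ∀ ε : ℝ, 0 < ε → ∀ᶠ n : ℕ in atTop, ∀ j : ℕ, Central k n j →
      (#((slice n j).filter fun x => 2 ≤ cliqueCount n k x) : ℝ) ≤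
        ((1 / (k.factorial : ℝ)) ^ 2 / 2 + ε) * #(slice n j)) →
    (∀ k : ℕ, 3 ≤ k → ∀ ε : ℝ, 0 < ε → ∀ᶠ n : ℕ in atTop, ∀ j : ℕ, Central k n j →
      (1 / (k.factorial : ℝ) - (1 / (k.factorial : ℝ)) ^ 2 / 2 - ε) * #(slice n j) ≤
        #((slice n j).filter fun x => cliqueFn n k x = true)) →
    (∀ k : ℕ, 3 ≤ k → ∀ ε : ℝ, 0 < ε → ∀ᶠ n : ℕ in atTop, ∀ j : ℕ, Central k n j →
      ∀ F : Finset (Edge n), 2 * #F ≤ n.choose 2 →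
        ∑ ρ ∈ (slice n j).image (fun x e => if e ∈ F then x e else false),
            (#((slice n j).filter fun x => (∀ e ∈ F, x e = ρ e) ∧ cliqueFn n k x = true) : ℝ) ^ 2 /
              #((slice n j).filter fun x => ∀ e ∈ F, x e = ρ e) ≤
          ((1 / (k.factorial : ℝ)) ^ 2 + 1 / (k.factorial : ℝ) * (#F / (n.choose 2 : ℕ)) + ε) * #(slice n j)) →
    (∀ c : ℕ, 2 ≤ c → ∃ k : ℕ, 4 ≤ k ∧ ∃ δ : ℝ, (1 / (k.factorial : ℝ)) ^ 2 < δ ∧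
      ∀ᶠ n : ℕ in atTop, ∀ j : ℕ, Central k n j → ∀ C : Circuit (Edge n), C.IsOver monotoneBasis →
        n.choose 2 ≤ 4 * C.size + 1 →
        (#((slice n j).filter fun x => C.eval x ≠ decide (¬ 2 ∣ cliqueCount n k x)) : ℝ) ≤ δ * #(slice n j) →
          n ^ c < C.size) →
    ∀ c : ℕ, 2 ≤ c → ∃ k : ℕ, 3 ≤ k ∧ ∃ δ : ℝ, (1 / (k.factorial : ℝ)) ^ 2 < δ ∧
      ∀ᶠ n : ℕ in atTop, ∀ j : ℕ, Central k n j → ∀ C : Circuit (Edge n), C.IsOver monotoneBasis →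
        thr k n ≤ 16 * C.size + 8 →
        (#((slice n j).filter fun x => C.eval x ≠ decide (¬ 2 ∣ cliqueCount n k x)) : ℝ) ≤ δ * #(slice n j) →
          n ^ c < C.size := by
  intro hTail hB2 hB3 hPar c hc
  obtain ⟨k, hk, δ, hδ, hP⟩ := hPar c hc
  have hk3 : 3 ≤ k := by omega
  set lam : ℝ := 1 / (k.factorial : ℝ) with hlam
  have hlam0 : 0 < lam := by positivity
  have hlam24 : lam ≤ 1 / 24 := by
    have h : (Nat.factorial 4 : ℝ) ≤ k.factorial := by exact_mod_cast Nat.factorial_le hk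
    have h4 : (Nat.factorial 4 : ℝ) = 24 := by norm_num [Nat.factorial]
    rw [hlam]
    exact one_div_le_one_div_of_le (by norm_num) (by linarith)
  set t : ℝ := lam ^ 2 with ht
  have htlam : t ≤ lam / 24 := by rw [ht]; nlinarith
  set δ' : ℝ := min δ ((lam / 8 - t / 2) / 2) with hδ'
  set ε : ℝ := (lam / 8 - t / 2) / 4 with hε
  have hε0 : 0 < ε := by rw [hε]; nlinarith
  have hδ't : t < δ' := by
    rw [hδ']
    refine lt_min hδ ?_
    nlinarith
  refine ⟨k, hk3, δ', hδ't, ?_⟩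
  filter_upwards [hTail k hk3 ε hε0, hP, bigBlindFloor_of hB2 hB3 hk] with n hT hPn hfl
  intro j hj C hC _hwin herr
  have hS0 : (0 : ℝ) ≤ #(slice n j) := Nat.cast_nonneg _
  -- clique accuracy `≤ λ/8` from parity accuracy `δ'` and the tail
  have hsub : errSet n k j C ⊆
      ((slice n j).filter fun x => C.eval x ≠ decide (¬ 2 ∣ cliqueCount n k x)) ∪
        (slice n j).filter fun x => 2 ≤ cliqueCount n k x := by
    intro x hx
    obtain ⟨-, hxj, hne⟩ := mem_filter.1 hx
    have hxs : x ∈ slice n j := mem_filter.2 ⟨mem_univ _, hxj⟩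
    rw [mem_union]
    by_cases h2 : 2 ≤ cliqueCount n k x
    · exact Or.inr (mem_filter.2 ⟨hxs, h2⟩)
    · left
      refine mem_filter.2 ⟨hxs, ?_⟩
      rwa [← Summit.PneNP.PneNP.Theorems.SliceTarget.Negative.cliqueFn_eq_parity_of_lt_two x (by omega)]
  have hcard : (#(errSet n k j C) : ℝ) ≤
      #((slice n j).filter fun x => C.eval x ≠ decide (¬ 2 ∣ cliqueCount n k x)) +
        #((slice n j).filter fun x => 2 ≤ cliqueCount n k x) := by
    have := (card_le_card hsub).trans (card_union_le _ _)
    exact_mod_cast this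
  have hsum : δ' + (t / 2 + ε) ≤ lam / 8 := by
    have : δ' ≤ (lam / 8 - t / 2) / 2 := min_le_right _ _
    rw [hε]; nlinarith
  have herrB : (#(errSet n k j C) : ℝ) ≤ 1 / (k.factorial : ℝ) / 8 * #(slice n j) := by
    calc (#(errSet n k j C) : ℝ)
        ≤ #((slice n j).filter fun x => C.eval x ≠ decide (¬ 2 ∣ cliqueCount n k x)) +
            #((slice n j).filter fun x => 2 ≤ cliqueCount n k x) := hcard
      _ ≤ δ' * #(slice n j) + (t / 2 + ε) * #(slice n j) := add_le_add herr (hT j hj)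
      _ = (δ' + (t / 2 + ε)) * #(slice n j) := by ring
      _ ≤ lam / 8 * #(slice n j) := mul_le_mul_of_nonneg_right hsum hS0
      _ = 1 / (k.factorial : ℝ) / 8 * #(slice n j) := by rw [hlam]
  have hwin : n.choose 2 ≤ 4 * C.size + 1 := hfl j hj C hC herrB
  have herrδ : (#((slice n j).filter fun x => C.eval x ≠ decide (¬ 2 ∣ cliqueCount n k x)) : ℝ) ≤
      δ * #(slice n j) := herr.trans (mul_le_mul_of_nonneg_right (min_le_left _ _) hS0)
  exact hPn j hj C hC hwin herrδ

end

end Summit.PneNP.PneNP.Cruxes.SliceTarget.Ideator3Line
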